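import Summits.ResolutionOfSingularities.ResolutionOfSingularities.Theses.FrobeniusLadder
import Summits.ResolutionOfSingularities.ResolutionOfSingularities.Theorems.FrobeniusLadderFRationalModificationCertifiedModel
import Summits.ResolutionOfSingularities.ResolutionOfSingularities.Theorems.FrobeniusLadderFRationalModificationReduction
import Summits.ResolutionOfSingularities.ResolutionOfSingularities.Theorems.FrobeniusLadderFRationalModificationHullsNoCM
import HarnessLib

/-!
# The crux `FRationalModification` from an F-injective Cartier hull of a RUNG-2 variety
(crux `FrobeniusLadder.FRationalModification`, stmt-ResolutionOfSingularities-15316, line `birth` v3.4,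
chain C — the weakest hull statement that closes the crux)

Line `birth` closes the crux from an "F-injective Cartier hull" statement, of which the tree now holds
two sufficient forms: the registered CM form (`Lines/birth.lean`, `stub_fInjectiveCartierHull`: input an
integral Cohen–Macaulay `W` with an effective Cartier `D`, `W` regular off `Supp D`; needs the named fact
`CesnaviciusMacaulayfication` to be fed) and the CM-free form (chain B, `HullsNoCM`: input any integral
`W` with such a `D`; no fact). Both IGNORE the Frobenius half of the crux's antecedent. This file
records the third and WEAKEST sufficient form, chain C, which uses the rung-2 antecedent in full and asks
for no Cartier input at all:

  (HullOfRungTwo) every INTEGRAL separated finite-type `Y/k` (`char k = p`) all of whose stalks are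
  rung-2 (domains, every system of parameters a weakly regular sequence generating a Frobenius-closed
  ideal — i.e. `Y` Cohen–Macaulay and F-injective) has a proper birational `W' → Y` carrying an
  effective Cartier `D'` with `W'` regular off `Supp D'` and, on `Supp D'`, domain stalks whose boundary
  ring `𝒪_{W',w}/D'_w` is Cohen–Macaulay and F-injective.

`fRationalModification_of_hullOfRungTwo : HullOfRungTwo → FRationalModification` (sorry-free, no named
fact): reduce to the integral rung-2 components (`Reduction.stub_reduction`), take the hull, and read
rung 3 off the boundary by regularity (`Negative.rungThree_of_isRegularLocalRing`) and on it by the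
Fedder–Watanabe inversion along the Cartier certificate (`CertifiedModel.rungThree_of_cartierCertificate`,
unconditional over every field). Conversely chain B's CM-free form implies HullOfRungTwo
(`hullOfRungTwo_of_noCM`: blow up the non-regular locus first, `HullsNoCM.cartierHull_of_blowup`), so the
promotion menu for the planners is, from strongest to weakest statement:
CM-free form ⇒ CM form (⇔ CM-free modulo `CesnaviciusMacaulayfication`, `MacaulayfyHull`) and
CM-free form ⇒ HullOfRungTwo; each of the three closes the crux.

## References

* R. Fedder, K.-i. Watanabe, *A characterization of F-regularity in terms of F-purity*, MSRI Publ. 15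
  (1989), Prop. 2.13. [FedderWatanabe1989]
* The Stacks Project, Tags 02ND, 02OS (blowing up). [StacksProject]
-/

-- single-problem summit: the doubled namespace component `ResolutionOfSingularities` is forced
set_option linter.dupNamespace false

noncomputable section

open CategoryTheory AlgebraicGeometry TopologicalSpace IsLocalRing
open Literature.AlgebraicGeometry.Resolution
open Summit.ResolutionOfSingularities.ResolutionOfSingularities.Theses.FrobeniusLadder

namespace Summit.ResolutionOfSingularities.ResolutionOfSingularities.Theorems.FRationalModification.HullOfRungTwo

/-- **Chain C: the crux from an F-injective Cartier hull of every integral rung-2 variety** (no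
Cohen–Macaulay convenience beyond the antecedent itself, no Cartier input, no named fact). If every
integral separated finite-type `Y/k` (`char k = p`) with rung-2 stalks (domain, Cohen–Macaulay,
F-injective in the route's inline system-of-parameters language) admits a proper birational `W' → Y`
with an effective Cartier `D'`, `W'` regular off `Supp D'`, and Cohen–Macaulay F-injective boundary
rings `𝒪_{W',w}/D'_w` at the (domain) stalks on `Supp D'` (hypothesis `hH`), then
`FRationalModification` holds. [cite: FedderWatanabe1989, Prop. 2.13] -/
theorem fRationalModification_of_hullOfRungTwo
    (hH : ∀ (p : ℕ) [Fact p.Prime] (k : Type) [Field k] [CharP k p] (Y : Scheme.{0})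
      (g : Y ⟶ Spec (.of k)) [IsSeparated g] [LocallyOfFiniteType g] [QuasiCompact g] [IsIntegral Y],
      (∀ y : Y, IsDomain (Y.presheaf.stalk y) ∧ ∀ d : ℕ, ringKrullDim (Y.presheaf.stalk y) = d →
        ∀ s : Fin d → Y.presheaf.stalk y, (Ideal.span (Set.range s)).radical.IsMaximal →
          RingTheory.Sequence.IsWeaklyRegular (Y.presheaf.stalk y) (List.ofFn s) ∧
          ∀ w : Y.presheaf.stalk y, (∃ e : ℕ, w ^ p ^ e ∈
            Ideal.span ((fun z : Y.presheaf.stalk y => z ^ p ^ e) ''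
              (Ideal.span (Set.range s) : Set (Y.presheaf.stalk y)))) →
            w ∈ Ideal.span (Set.range s)) →
      ∃ (W' : Scheme.{0}) (π : W' ⟶ Y), IsProper π ∧ IsBirational π ∧
        ∃ D' : W'.IdealSheafData, IsEffectiveCartier D' ∧
          (∀ w : W', w ∉ D'.support → IsRegularLocalRing (W'.presheaf.stalk w)) ∧
          (∀ w : W', w ∈ D'.support → IsDomain (W'.presheaf.stalk w) ∧
            ∀ d : ℕ, ringKrullDim (W'.presheaf.stalk w ⧸ stalkIdeal D' w) = d →
              ∀ t : Fin d → W'.presheaf.stalk w ⧸ stalkIdeal D' w,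
                (Ideal.span (Set.range t)).radical.IsMaximal →
                  RingTheory.Sequence.IsWeaklyRegular (W'.presheaf.stalk w ⧸ stalkIdeal D' w)
                    (List.ofFn t) ∧
                  ∀ y : W'.presheaf.stalk w ⧸ stalkIdeal D' w, (∃ e : ℕ, y ^ p ^ e ∈
                    Ideal.span ((fun z : W'.presheaf.stalk w ⧸ stalkIdeal D' w => z ^ p ^ e) ''
                      (Ideal.span (Set.range t) :
                        Set (W'.presheaf.stalk w ⧸ stalkIdeal D' w)))) →
                    y ∈ Ideal.span (Set.range t))) :
    FRationalModification := by
  intro p hp k _ _ X f hsep hft hqc _ hX₁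
  haveI : Fact p.Prime := ⟨hp⟩
  haveI := hsep; haveI := hft; haveI := hqc
  refine Reduction.stub_reduction p k X f (fun Y g hs hl hq hY h₂ => ?_) hX₁
  haveI := hs; haveI := hl; haveI := hq; haveI := hY
  -- the hull of the integral rung-2 scheme `Y`
  obtain ⟨W', π', hπ', hbir', D', hD', hreg', hcert⟩ := hH p k Y g h₂
  haveI := hπ'
  haveI : IsLocallyNoetherian W' := LocallyOfFiniteType.isLocallyNoetherian (π' ≫ g)
  refine ⟨W', π', inferInstance, hbir', fun w => ?_⟩
  by_cases hw : w ∈ D'.support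
  · -- on the boundary: the Cartier certificate
    obtain ⟨hdom, hc⟩ := hcert w hw
    haveI := hdom
    exact CertifiedModel.rungThree_of_cartierCertificate p k (π' ≫ g) hD' hw hreg' hc
  · -- off the boundary: regular, hence rung-3
    haveI : CharP (W'.presheaf.stalk w) p := Negative.charP_stalk (π' ≫ g) w
    exact Negative.rungThree_of_isRegularLocalRing hp _ (hreg' w hw)

/-- **Chain B's CM-free form implies chain C's `HullOfRungTwo`**: given an integral (rung-2 or not)
`Y/k`, blow up its non-regular locus (`HullsNoCM.cartierHull_of_blowup`: proper birational integral
`W → Y` with an effective Cartier `D`, `W` regular off `Supp D`), apply the CM-free F-injective Cartier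
hull to `(W, D)`, and compose. So `HullOfRungTwo` is the weakest of the three sufficient hull statements.
[cite: StacksProject, Tags 02ND and 02OS] -/
theorem hullOfRungTwo_of_noCM
    (hFIH : ∀ (p : ℕ) [Fact p.Prime] (k : Type) [Field k] [CharP k p] (W : Scheme.{0})
      (g : W ⟶ Spec (.of k)) [IsSeparated g] [LocallyOfFiniteType g] [QuasiCompact g] [IsIntegral W]
      (D : W.IdealSheafData), IsEffectiveCartier D →
        (∀ w : W, w ∉ D.support → IsRegularLocalRing (W.presheaf.stalk w)) →
        ∃ (W' : Scheme.{0}) (π : W' ⟶ W), IsProper π ∧ IsBirational π ∧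
          ∃ D' : W'.IdealSheafData, IsEffectiveCartier D' ∧
            (∀ w : W', w ∉ D'.support → IsRegularLocalRing (W'.presheaf.stalk w)) ∧
            (∀ w : W', w ∈ D'.support → IsDomain (W'.presheaf.stalk w) ∧
              ∀ d : ℕ, ringKrullDim (W'.presheaf.stalk w ⧸ stalkIdeal D' w) = d →
                ∀ t : Fin d → W'.presheaf.stalk w ⧸ stalkIdeal D' w,
                  (Ideal.span (Set.range t)).radical.IsMaximal →
                    RingTheory.Sequence.IsWeaklyRegular (W'.presheaf.stalk w ⧸ stalkIdeal D' w)
                      (List.ofFn t) ∧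
                    ∀ y : W'.presheaf.stalk w ⧸ stalkIdeal D' w, (∃ e : ℕ, y ^ p ^ e ∈
                      Ideal.span ((fun z : W'.presheaf.stalk w ⧸ stalkIdeal D' w => z ^ p ^ e) ''
                        (Ideal.span (Set.range t) :
                          Set (W'.presheaf.stalk w ⧸ stalkIdeal D' w)))) →
                      y ∈ Ideal.span (Set.range t)))
    (p : ℕ) [Fact p.Prime] (k : Type) [Field k] [CharP k p] (Y : Scheme.{0})
    (g : Y ⟶ Spec (.of k)) [IsSeparated g] [LocallyOfFiniteType g] [QuasiCompact g] [IsIntegral Y]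
    (_h₂ : ∀ y : Y, IsDomain (Y.presheaf.stalk y) ∧ ∀ d : ℕ, ringKrullDim (Y.presheaf.stalk y) = d →
      ∀ s : Fin d → Y.presheaf.stalk y, (Ideal.span (Set.range s)).radical.IsMaximal →
        RingTheory.Sequence.IsWeaklyRegular (Y.presheaf.stalk y) (List.ofFn s) ∧
        ∀ w : Y.presheaf.stalk y, (∃ e : ℕ, w ^ p ^ e ∈
          Ideal.span ((fun z : Y.presheaf.stalk y => z ^ p ^ e) ''
            (Ideal.span (Set.range s) : Set (Y.presheaf.stalk y)))) →
          w ∈ Ideal.span (Set.range s)) :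
    ∃ (W' : Scheme.{0}) (π : W' ⟶ Y), IsProper π ∧ IsBirational π ∧
      ∃ D' : W'.IdealSheafData, IsEffectiveCartier D' ∧
        (∀ w : W', w ∉ D'.support → IsRegularLocalRing (W'.presheaf.stalk w)) ∧
        (∀ w : W', w ∈ D'.support → IsDomain (W'.presheaf.stalk w) ∧
          ∀ d : ℕ, ringKrullDim (W'.presheaf.stalk w ⧸ stalkIdeal D' w) = d →
            ∀ t : Fin d → W'.presheaf.stalk w ⧸ stalkIdeal D' w,
              (Ideal.span (Set.range t)).radical.IsMaximal →
                RingTheory.Sequence.IsWeaklyRegular (W'.presheaf.stalk w ⧸ stalkIdeal D' w)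
                  (List.ofFn t) ∧
                ∀ y : W'.presheaf.stalk w ⧸ stalkIdeal D' w, (∃ e : ℕ, y ^ p ^ e ∈
                  Ideal.span ((fun z : W'.presheaf.stalk w ⧸ stalkIdeal D' w => z ^ p ^ e) ''
                    (Ideal.span (Set.range t) : Set (W'.presheaf.stalk w ⧸ stalkIdeal D' w)))) →
                  y ∈ Ideal.span (Set.range t)) := by
  -- the Cartier hull of the non-regular locus (a blow-up)
  obtain ⟨W, π, hπ, hbir, hW, D, hD, hreg, -⟩ := HullsNoCM.cartierHull_of_blowup k Y g
  haveI := hπ; haveI := hW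
  -- the F-injective Cartier hull over it (`W/k` through `π ≫ g`), then compose
  obtain ⟨W', π', hπ', hbir', hrest⟩ := hFIH p k W (π ≫ g) D hD hreg
  haveI := hπ'
  exact ⟨W', π' ≫ π, inferInstance, ComponentGluing.IsBirational.comp hbir' hbir, hrest⟩

end Summit.ResolutionOfSingularities.ResolutionOfSingularities.Theorems.FRationalModification.HullOfRungTwo

end
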